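import Literature.NumberTheory.GaloisCohomology.Howard2004.PrincipalArtinianQuotMorphismProofs
import Mathlib.Algebra.Module.Submodule.Pointwise
import Mathlib.LinearAlgebra.Finsupp.LinearCombination
import HarnessLib

/-!
# Exact `π`-divisibility below the length in a free module over a principal Artinian coefficient ring
# (theorems only; no definition, no named fact, no `sorry`)

B. Howard, *The Heegner point Kolyvagin system*, Compositio Math. 140 (2004) (arXiv:1202.6340), Rem. 1.1.4 (p. 5
L100–105: `R` principal Artinian of length `k`, `𝔪 = πR`) with H.0 (p. 7 L57: `T` free of rank two over `R`) and
§1.6 (p. 12 L29–55: the tower `T/𝔪^kT`; the multiplications `π^{j-i} : T/𝔪^i → T/𝔪^j` are INJECTIVE).  In a free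
module `T` over such an `R` (length `e`), multiplication by `π^n` is injective «modulo `π^c`» as long as
`c + n ≤ e`: `π^n x ∈ π^{c+n}T ⇒ x ∈ π^cT`.  This is the field `smul_mem_cancel` of the π-adic refinement datum
(`Howard2004/PiAdicRefinement`: it makes `×π^n : T/π^ℓ → T/π^{ℓ+n}` injective), discharged here from H.0-type freeness:

* §1 `mem_span_pow_of_pow_mul_mem` — the scalar case in `R` (via p649124 `exists_unit_mul_pow_eq`,
  `le_of_pow_mem_span_pow`);
* §2 `mem_smul_top_iff_forall_coord` (`x ∈ I·T ↔` all coordinates in `I`, `T` free) and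
  **`mem_span_pow_smul_top_of_pow_smul_mem`** — the module case;
* §3 `mem_span_singleton_smul_top_iff_of_isScalarTower` — `(r)·T` over `R` is `(algebraMap r)·T` over an `R`-algebra
  `A` acting compatibly (so the statement transfers from the level ring `A_{m,k}` to `S_𝔮` acting through it), and the
  transferred form **`mem_span_pow_smul_top_of_pow_smul_mem_of_isScalarTower`**.

Everything is [folklore] commutative algebra recorded against Howard's Rem. 1.1.4 / H.0 / §1.6.  Cell `pub/bsd-print-x9`,
shared μ-item of rows 9/10 (D1 road, `SatisfiesH.h3`); seat `bsd-line-x10b-p1-w6`.  BSD is not proved by any of this.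
-/

set_option autoImplicit false

noncomputable section

open Function
open scoped Pointwise

namespace Literature.NumberTheory.GaloisCohomology.Howard2004

/-! ## §1 The scalar case -/

section Ring

variable {R : Type} [CommRing R] [IsLocalRing R] {π : R} {e : ℕ}

/-- **`π^n r ∈ (π^{c+n}) ⇒ r ∈ (π^c)` for `c + n ≤ e`** in a principal Artinian local ring of length `e` (`𝔪 = (π)`,
`π^e = 0 ≠ π^{e-1}`): write `r = uπ^s`; if `s < c` then `π^{n+s} ∈ (π^{c+n})` with `n + s < e` forces `c + n ≤ n + s`.
[cite: Howard2004HeegnerKolyvagin, Rem. 1.1.4 and §1.6 (arXiv p. 5 L100–105; p. 12 L29–55: the injective maps π^{j-i})] -/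
theorem mem_span_pow_of_pow_mul_mem (hmax : IsLocalRing.maximalIdeal R = Ideal.span {π}) (hn : π ^ e = 0)
    (hn' : e ≠ 0 → π ^ (e - 1) ≠ 0) {c n : ℕ} (hcn : c + n ≤ e) {r : R}
    (h : π ^ n * r ∈ Ideal.span {π ^ (c + n)}) : r ∈ Ideal.span {π ^ c} := by
  obtain ⟨s, u, hs, rfl⟩ := exists_unit_mul_pow_eq hmax hn r
  rcases Nat.lt_or_ge s c with hlt | hle
  · exfalso
    have hmem : π ^ (n + s) ∈ Ideal.span {π ^ (c + n)} := by
      have h' := Ideal.mul_mem_left _ ((u⁻¹ : Rˣ) : R) h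
      rwa [mul_left_comm, ← mul_assoc ((u⁻¹ : Rˣ) : R), Units.inv_mul, one_mul, ← pow_add] at h'
    have := le_of_pow_mem_span_pow hmax hn' (by omega) hmem
    omega
  · rw [Ideal.mem_span_singleton']
    exact ⟨u * π ^ (s - c), by rw [mul_assoc, ← pow_add, Nat.sub_add_cancel hle]⟩

end Ring

/-! ## §2 The free-module case -/

section Free

variable {R : Type} [CommRing R] {M : Type} [AddCommGroup M] [Module R M]

/-- **`x ∈ I · T` iff every coordinate of `x` lies in `I`** (`T` free with basis `b`).
[cite: Howard2004HeegnerKolyvagin, H.0 and Def. 1.1.3 (arXiv p. 7 L57; p. 5 L93–99: the submodules IT of a free T)] -/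
theorem mem_smul_top_iff_forall_coord {ι : Type*} (b : Module.Basis ι R M) (I : Ideal R) (x : M) :
    x ∈ I • (⊤ : Submodule R M) ↔ ∀ i, b.coord i x ∈ I := by
  constructor
  · intro h i
    have hmap : (b.coord i) x ∈ (I • (⊤ : Submodule R M)).map (b.coord i) := Submodule.mem_map_of_mem h
    rw [Submodule.map_smul''] at hmap
    have hle : I • ((⊤ : Submodule R M).map (b.coord i)) ≤ (I : Submodule R R) :=
      Submodule.smul_le.mpr fun r hr y _ => I.mul_mem_right y hr
    exact hle hmap
  · intro h
    rw [← b.linearCombination_repr x, Finsupp.linearCombination_apply]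
    refine Submodule.finsuppSum_mem _ _ _ _ fun i _ => ?_
    exact Submodule.smul_mem_smul (by simpa [b.coord_apply] using h i) Submodule.mem_top

variable [IsLocalRing R] {π : R} {e : ℕ}

/-- **Exact `π`-divisibility below the length, module case**: for `T` free over a principal Artinian local ring of
length `e` (`𝔪 = (π)`, `π^e = 0 ≠ π^{e-1}`) and `c + n ≤ e`, `π^n • x ∈ π^{c+n} · T ⇒ x ∈ π^c · T` (coordinatewise §1).
This is why `×π^n : T/π^ℓT → T/π^{ℓ+n}T` is injective for `ℓ + n ≤ e`.
[cite: Howard2004HeegnerKolyvagin, Rem. 1.1.4, H.0 and §1.6 (arXiv p. 5 L100–105, p. 7 L57, p. 12 L29–55)] -/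
theorem mem_span_pow_smul_top_of_pow_smul_mem [Module.Free R M]
    (hmax : IsLocalRing.maximalIdeal R = Ideal.span {π}) (hn : π ^ e = 0) (hn' : e ≠ 0 → π ^ (e - 1) ≠ 0)
    {c n : ℕ} (hcn : c + n ≤ e) {x : M}
    (h : π ^ n • x ∈ Ideal.span {π ^ (c + n)} • (⊤ : Submodule R M)) :
    x ∈ Ideal.span {π ^ c} • (⊤ : Submodule R M) := by
  let b := Module.Free.chooseBasis R M
  rw [mem_smul_top_iff_forall_coord b] at h ⊢
  intro i
  refine mem_span_pow_of_pow_mul_mem hmax hn hn' hcn ?_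
  have := h i
  rwa [map_smul, smul_eq_mul] at this

/-- The same with the hypotheses packaged as `IsPrincipalArtinianOfLength R e`.
[cite: Howard2004HeegnerKolyvagin, Rem. 1.1.4, H.0 and §1.6 (arXiv p. 5 L100–105, p. 7 L57, p. 12 L29–55)] -/
theorem mem_span_pow_smul_top_of_pow_smul_mem' [Module.Free R M]
    (hmax : IsLocalRing.maximalIdeal R = Ideal.span {π}) (hP : IsPrincipalArtinianOfLength R e)
    {c n : ℕ} (hcn : c + n ≤ e) {x : M}
    (h : π ^ n • x ∈ Ideal.span {π ^ (c + n)} • (⊤ : Submodule R M)) :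
    x ∈ Ideal.span {π ^ c} • (⊤ : Submodule R M) :=
  mem_span_pow_smul_top_of_pow_smul_mem hmax (pow_eq_zero_of_isPrincipalArtinianOfLength hP hmax)
    (pow_pred_ne_zero_of_isPrincipalArtinianOfLength hP hmax) hcn h

end Free

/-! ## §3 Transfer along a scalar tower `R → A → End(T)` -/

section Tower

variable {R : Type} [CommRing R] {A : Type} [CommRing A] [Algebra R A] {M : Type} [AddCommGroup M]
  [Module A M] [Module R M] [IsScalarTower R A M]

/-- **`(r) · T` over `R` is `(algebraMap r) · T` over `A`** when `R` acts on `T` through the `R`-algebra `A`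
(both are `{r • y}`). Used to read the `S_𝔮`-submodules `π^i · T^{(k)}` of the Eisenstein levels over the level
ring `A_{m,k}`. [cite: Howard2004HeegnerKolyvagin, §1.6 and Rem. 1.2.4 (iii) (arXiv p. 12 L29–55; p. 7 L19–27: T as an R-module through R → R_k)] -/
theorem mem_span_singleton_smul_top_iff_of_isScalarTower (r : R) (x : M) :
    x ∈ Ideal.span {r} • (⊤ : Submodule R M) ↔ x ∈ Ideal.span {algebraMap R A r} • (⊤ : Submodule A M) := by
  rw [Submodule.ideal_span_singleton_smul, Submodule.ideal_span_singleton_smul,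
    Submodule.mem_smul_pointwise_iff_exists, Submodule.mem_smul_pointwise_iff_exists]
  constructor
  · rintro ⟨y, -, rfl⟩
    exact ⟨y, Submodule.mem_top, algebraMap_smul A r y⟩
  · rintro ⟨y, -, rfl⟩
    exact ⟨y, Submodule.mem_top, (algebraMap_smul A r y).symm⟩

variable [IsLocalRing A] {π : R} {e : ℕ}

/-- **Exact `π`-divisibility below the length, read over `R`**: `T` free over the principal Artinian local `R`-algebra
`A` of length `e` with `𝔪_A = (algebraMap π)`, `R` acting through `A`; then for `c + n ≤ e`,
`π^n • x ∈ (π^{c+n}) · T ⇒ x ∈ (π^c) · T` with the `R`-submodules `(π^j) · T` (the form of the field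
`PiRefinementDatum.smul_mem_cancel` for the Eisenstein levels over `S_𝔮`).
[cite: Howard2004HeegnerKolyvagin, Rem. 1.1.4, H.0 and §1.6 (arXiv p. 5 L100–105, p. 7 L57, p. 12 L29–55)] -/
theorem mem_span_pow_smul_top_of_pow_smul_mem_of_isScalarTower [Module.Free A M]
    (hmax : IsLocalRing.maximalIdeal A = Ideal.span {algebraMap R A π}) (hP : IsPrincipalArtinianOfLength A e)
    {c n : ℕ} (hcn : c + n ≤ e) {x : M}
    (h : π ^ n • x ∈ Ideal.span {π ^ (c + n)} • (⊤ : Submodule R M)) :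
    x ∈ Ideal.span {π ^ c} • (⊤ : Submodule R M) := by
  rw [mem_span_singleton_smul_top_iff_of_isScalarTower (A := A), map_pow] at h ⊢
  rw [← algebraMap_smul A (π ^ n) x, map_pow] at h
  exact mem_span_pow_smul_top_of_pow_smul_mem' hmax hP hcn h

end Tower

end Literature.NumberTheory.GaloisCohomology.Howard2004

end
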